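import Literature.AlgebraicGeometry.HodgeTheory.WeilClassesSixfolds
import Literature.AlgebraicGeometry.HodgeTheory.WeilClassesFourfolds
import HarnessLib

/-!
# Weil classes on abelian SIXFOLDS of split Weil type with `K = ℚ(i)` (Koike 2004, every member of the universal family)

Family `hodge`, layer `Literature/AlgebraicGeometry/HodgeTheory`. The `d = 1` twin of
`WeilClassesSixfoldsSqrtMinus3Schoen.lean` (Schoen 1998, `d = 3`): the CLASSICAL, REFEREED `ℚ(i)` sixfold case of the
Hodge–Weil problem, typed as the `d = 1` slice of the floor fact `Markman2025_weilClasses_algebraic_hyperbolicSixfold`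
(arXiv:2502.03415 Thm. 1.5.1, unrefereed: all `K`, discriminant `(-1)³`) with that fact's rendering of "split" as
`Motives.IsHyperbolicWeilType A φ 3 h` reused VERBATIM — no new definition. Requested by the B2b ladder `hodge-weil`
(packet `run/shared/lean/b2b/hodge-weil/`): a refereed trust base for the floor F0a at `K = ℚ(i)`, ALL members.

Source READ (held, `paper:arxiv-math_0211304`): K. Koike, *Algebraicity of some Weil Hodge classes*, Canad. Math.
Bull. 47 (2004) 566–572 = arXiv:math/0211304 [`Koike2004WeilHodge`; refereed], verbatim:

> (Abstract) "We show that the Prym map for 4-th cyclic étale covers of curves of genus 4 is a dominant morphism to a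
> Shimura variety for a family of Abelian 6-folds of Weil type. According to the result of Schoen, this implies
> algebraicity of Weil classes for this family."
> (§2) "The class `δ = det H` mod `(k^*)²` gives an isogenus invariant, and we call this the discriminant of
> `(A, E, φ)`. … Let us consider the Prym variety `P = Prym(C₁₃/C₇)` … This is a principally polarized
> 6-dimensional Abelian variety. The Galois group `Gal(C₁₃/C₄) ≅ ℤ/4ℤ` acts on `P`, and `P` becomes Abelian variety
> of Weil type for `ℚ(√-1)` by this action. It is known that the discriminant `δ` of `P` is `1` (see [vG2]), and the
> Weil classes `W(P)` are generated by algebraic cycles (see [Sc1])."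
> "**Theorem 2.1.** There exist a `4`-th cyclic étale cover `π : X → Z` of genus `4` curve `Z` such that the
> multiplication map `μ` in (mu) is an isomorphism, and therefore the Prym map `Pr` is dominant.
> By the specialization argument in [Sc1], we know that **Corollary 2.1.** The Weil classes are generated by
> algebraic cycles for Abelian `6`-folds of Weil type for `ℚ(√-1)` with `δ = 1`."

So Koike proves (Thm. 2.1 + Schoen's specialization argument [Sc1, p. 30]): the Weil classes of EVERY member of the
universal family of the component of `P` are algebraic. That component is SPLIT — NOT because of Koike's invariant
(`δ ∈ k^*/(k^*)²` is COARSER than the discriminant `det H ∈ ℚ^×/Nm(K^×)` of van Geemen 5.2 (3) / Markman §1.1, so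
"`δ = 1`" alone does not determine the component; B2b packet `GAPS.md` referee-g6 G13), but because `P = Prym(C₁₃/C₇)`
is the Prym variety of an UNRAMIFIED cyclic cover, hence of hyperbolic Weil type (a Lagrangian `K`-stable rational
`2n`-frame from the one-sheet lifts of a Lagrangian half-basis; B2b packet `b2b-hweil-pv3-g2/DISCRIMINANT-CORRECTION.md`:
"every unramified cyclic Prym is hyperbolic"), and Koike's theorem is about THAT component — which is
Markman's "discriminant `-1`" (arXiv:2502.03415 §1 p. 3: "It was later proved for sixfolds with `K = ℚ[√-1]` and
discriminant `−1` in [koike]") = the tree's `Motives.IsHyperbolicWeilType`; every abelian sixfold `(A, φ)`,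
`φ ≫ φ = -1`, of HYPERBOLIC Weil type is `K`-isogenous
to a fibre of that universal family (both `K`-Hermitian spaces hyperbolic of rank 6, hence isometric: Landherr 1936,
van Geemen 5.3–5.4; commensurable lattices — VERBATIM the reach clause (c) of the tree's `weilFamilyReach_hyperbolic`),
and algebraicity of the Weil plane is an isogeny invariant (van Geemen Thm. 6.12; tree: `WeilClassesIsogenyDescent`).
Hence the rendering below (all hyperbolic `ℚ(i)`-sixfolds) never asserts more than print.

## Rendering (identical conventions to `Markman2025_weilClasses_algebraic_hyperbolicSixfold`, at `d = 1`)

* `A : Motives.AbelianVariety ℂ`, `A.dim = 2 * 3`, smooth projective; `φ : A ⟶ A` with `φ ≫ φ = -(1 • 𝟙 A)` (`i ∈ End(A)`);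
* the polarization through a projective embedding `e` and a rational `a ≠ 0` in `H²(ℙᴺ(ℂ); ℂ)`; "`δ = 1`" (split) is
  `Motives.IsHyperbolicWeilType A φ 3 (1·e^*a + φ^*e^*a)`;
* "the Weil classes are generated by algebraic cycles": every rational `(3,3)` class of the Weil plane
  `weilClassesOf A φ 3 1 = E₊ ⊔ E₋` lies in `algebraicClasses A.X 3`.

Upper bound: an instance of the summit statement (`…_of_hodgeConjectureFor`). Relation to the floor: it IS the `d = 1`
instance of `Markman2025_weilClasses_algebraic_hyperbolicSixfold` (`…_of_markman`), but REFEREED (2004). Companion: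
`Schoen1998_weilClasses_algebraic_hyperbolicSixfold_three` (`d = 3`).

## References

* [Koike2004WeilHodge] K. Koike, Canad. Math. Bull. 47 (2004) 566–572 (arXiv:math/0211304), Thm. 2.1, Cor. 2.1, §2.
* [Schoen1988HodgeWeil] C. Schoen, Compositio Math. 65 (1988) 3–32, §3 and p. 30 (specialization).
* [vanGeemen1994HodgeAV] B. van Geemen, LNM 1594 (1994), 5.2–5.4, 6.12, 7.4.
* [Markman2025SecantWeil] E. Markman, arXiv:2502.03415, §1 p. 3 and Thm. 1.5.1.
-/

noncomputable section

open CategoryTheory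

namespace Literature.AlgebraicGeometry.HodgeTheory

open Literature.AlgebraicTopology.SingularHomology

section HodgeTheory

/-- **Koike 2004, Cor. 2.1 (with Thm. 2.1 and Schoen's specialization argument): for EVERY six-dimensional abelian
variety `(A, K)` of SPLIT Weil type with `K = ℚ(i)` (the component of the Prym `Prym(C₁₃/C₇)` of an unramified
cyclic cover, which is hyperbolic, i.e. of discriminant `(-1)³ = -1` mod norms; Koike's own label is "`δ = 1`") the
Weil classes are generated by algebraic cycles.** Rendering (module docstring): for `A` a smooth projective
complex abelian sixfold with `φ ≫ φ = -(1 • 𝟙 A)`, a projective embedding `e` and a rational `a ≠ 0` in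
`H²(ℙᴺ(ℂ); ℂ)` with `(A, φ)` of HYPERBOLIC Weil type for the `K`-symmetrised hyperplane class `h = 1·e^*a + φ^*e^*a`,
every rational `(3,3)` class of the Weil plane `weilClassesOf A φ 3 1` is algebraic (hyperbolic `(A, φ)` not
literally a fibre of Koike's universal family are `K`-isogenous to one — Landherr, van Geemen 5.3–5.4 — and
algebraicity of the Weil plane is isogeny invariant, van Geemen 6.12). The `d = 1` instance of
`Markman2025_weilClasses_algebraic_hyperbolicSixfold`, from a REFEREED source. Users take
`(h : Koike2004_weilClasses_algebraic_hyperbolicSixfold_one)`.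
[cite: Koike2004WeilHodge, Thm. 2.1 and Cor. 2.1 (§2)] [cite: Schoen1988HodgeWeil, §3 and p. 30]
[cite: vanGeemen1994HodgeAV, 5.3–5.4, Thm. 6.12 and 7.4] -/
def Koike2004_weilClasses_algebraic_hyperbolicSixfold_one : Prop :=
  ∀ (A : Motives.AbelianVariety ℂ) (φ : A ⟶ A), A.dim = 2 * 3 →
    Motives.IsSmoothProjective (2 * 3) A.X → φ ≫ φ = -((1 : ℕ) • 𝟙 A) →
      ∀ (e : Motives.ProjectiveEmbedding A.X)
        (a : complexBetti (Motives.projectiveSpace e.n ℂ) 2), IsRationalClass a → a ≠ 0 →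
        Motives.IsHyperbolicWeilType A φ 3
          (((1 : ℕ) : ℂ) • complexBetti.map e.ι 2 a +
            complexBetti.map φ.hom.hom.hom 2 (complexBetti.map e.ι 2 a)) →
          ∀ c : complexBetti A.X (2 * 3), IsRationalClass c →
            IsOfHodgeType (2 * 3) A.X (2 * 3) 3 3 c → c ∈ weilClassesOf A φ 3 1 →
              c ∈ algebraicClasses A.X 3

/-! ### Upper bound: the fact is an instance of the summit statement -/

/-- `HodgeConjectureFor` for all smooth projective varieties implies the fact (its instance over hyperbolic abelian
sixfolds with `K = ℚ(i)`, restricted to the Weil plane). [cite: Deligne2000, §1] -/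
theorem Koike2004_weilClasses_algebraic_hyperbolicSixfold_one_of_hodgeConjectureFor
    (h : ∀ ⦃n : ℕ⦄ ⦃X : Motives.SchemeOver ℂ⦄, Motives.IsSmoothProjective n X → HodgeConjectureFor n X) :
    Koike2004_weilClasses_algebraic_hyperbolicSixfold_one :=
  fun _ _ _ hX _ _ _ _ _ _ c hc h33 _ ↦ (h hX).2 3 c hc h33

/-! ### Relation to the floor -/

/-- Markman's sixfold theorem (all `K`, discriminant `(-1)³`; unrefereed preprint, the tree's
`Markman2025_weilClasses_algebraic_hyperbolicSixfold`) implies Koike's refereed `ℚ(i)` case: it is its instance `d = 1`.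
[cite: Markman2025SecantWeil, Thm. 1.5.1 and §1 p. 3] -/
theorem Koike2004_weilClasses_algebraic_hyperbolicSixfold_one_of_markman
    (h : Markman2025_weilClasses_algebraic_hyperbolicSixfold) :
    Koike2004_weilClasses_algebraic_hyperbolicSixfold_one :=
  fun A φ hA hX hφ e a ha ha0 hhyp c hc h33 hW ↦ h 1 (by norm_num) A φ hA hX hφ e a ha ha0 hhyp c hc h33 hW

end HodgeTheory

end Literature.AlgebraicGeometry.HodgeTheory

end
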